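import Summits.NavierStokesRegularity.NavierStokesRegularity.Theorems.IntenseSetDoorsAssemblyTools
import Summits.NavierStokesRegularity.NavierStokesRegularity.Theorems.IntenseSetDoorsLambPairing
import Literature.Analysis.FluidPDE.NearBeltramiEnstrophyCriterion
import Literature.Analysis.FluidPDE.LeiZhang2011Proofs
import Literature.Analysis.FluidPDE.DivFreeL3Approximation
import Literature.Analysis.FluidPDE.CKNEpsilonRegularityLemma142Holds
import HarnessLib

/-!
# S34 «IntenseSetDoors» — plate A34-A «CriticalCalmPowerBoundAssembly» PROVED

Summits-side proof file (theorems only) for door family S34 (nsreg-p1 g28, ROUND-32; texts of record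
`r32/Sketch34.lean` c542dddc314f2f7c = tree P0 `Theorems/IntenseSetDoorsDefs.lean`):
`criticalCalmPowerBoundAssembly_holds : CriticalCalmPowerBoundAssembly`, i.e.
`ValueCutoffLowStretching → LambPairingBound → ForcedPowerGronwallSlab → CriticalCalmPowerBound`,
BY NAME against the Prop names of P0 (V34, L34, G34 are HYPOTHESES here).

Proof (PLATE-AID-34 §A34-A; skeleton = A33): given `ε₀`, `η := (√3/(4ε₀) − 1)/2`, `a := (2/√3)(1+η)ε₀
< 1/2`, `C = C_η` from L34, `K₆` the tree's `H¹ ⊂ L⁶` constant, `ε₁ := 1/(C K₆ + 1)` (chosen before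
`ν, T, t₀, u`). At a slab time `s`, level `L := ε₀/(T − s)`: the engine
`two_mul_integral_stretching_le_lamb` gives `2∫⟪ω,(∇u)ω⟫ ≤ (a/(T − s))∫|ω|² + C√D√Λ`; on the intense
set Hölder `(3/2, 3)` + `‖v × ω‖ ≤ ‖v‖‖ω‖` + Sobolev (`FarhatGrujic2018.integral_norm_pow_six_le`) give
`Λ ≤ (ε₁νK₆)²D`, so `C√D√Λ ≤ (CK₆ε₁)νD ≤ νD`; then G34 with `β = 0`, the output conversion, and time
translation.
HONEST FRAME: V34/L34/G34 are hypotheses by name; S34-A is a regularity CRITERION (`L³`-calm velocity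
on the critical core ⇒ continuation); item 0056 `NoTypeII` / NS regularity NOT proved.
-/

noncomputable section

set_option linter.dupNamespace false

open MeasureTheory Set Function Filter Metric Real InnerProductSpace
open _root_.Topology
open scoped ENNReal NNReal RealInnerProductSpace ContDiff
open Literature.Analysis Literature.Analysis.FluidPDE
open Summit.NavierStokesRegularity.NavierStokesRegularity.Theorems.CriticalCoherenceDoor
  (exponent_of_lt_sqrt_three_div_four)

namespace Summit.NavierStokesRegularity.NavierStokesRegularity.Theorems.IntenseSetDoors

-- nested operator types (second derivatives)
set_option maxSynthPendingDepth 3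

/-! ### §1 Small tools -/

/-- Door hypotheses to Bochner set integrals, cubic version: `∫⁻_S ‖F‖ₑ³ ≤ ofReal r`, `0 ≤ r`, give
`∫_S ‖F‖³ ≤ r`. [folklore] -/
theorem setIntegral_norm_cube_le_of_lintegral_le {S : Set (EuclideanSpace ℝ (Fin 3))}
    {F : (EuclideanSpace ℝ (Fin 3)) → (EuclideanSpace ℝ (Fin 3))} (hF : Continuous F) {r : ℝ}
    (h : ∫⁻ x in S, ‖F x‖ₑ ^ 3 ≤ ENNReal.ofReal r) (hr : 0 ≤ r) : ∫ x in S, ‖F x‖ ^ 3 ≤ r := by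
  have hc : Continuous fun x => ‖F x‖ ^ 3 := hF.norm.pow 3
  rw [integral_eq_lintegral_of_nonneg_ae (Eventually.of_forall fun x => by positivity)
    hc.aestronglyMeasurable]
  have h' : ∫⁻ x in S, ENNReal.ofReal (‖F x‖ ^ 3) ≤ ENNReal.ofReal r := by
    refine le_trans (le_of_eq (lintegral_congr fun x => ?_)) h
    rw [ENNReal.ofReal_pow (norm_nonneg _), ofReal_norm]
  calc (∫⁻ x in S, ENNReal.ofReal (‖F x‖ ^ 3)).toReal ≤ (ENNReal.ofReal r).toReal :=
        ENNReal.toReal_mono ENNReal.ofReal_ne_top h'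
    _ = r := ENNReal.toReal_ofReal hr

/-- `(x²)³ = x⁶` (real exponent). [folklore] -/
theorem sq_rpow_three {x : ℝ} (hx : 0 ≤ x) : (x ^ 2) ^ (3 : ℝ) = x ^ 6 := by
  rw [← Real.rpow_natCast x 2, ← Real.rpow_mul hx, ← Real.rpow_natCast x 6]
  norm_num

/-- `(x⁶)^{1/3} = x²` for `x ≥ 0`. [folklore] -/
theorem pow_six_rpow_third {x : ℝ} (hx : 0 ≤ x) : (x ^ 6) ^ (1 / 3 : ℝ) = x ^ 2 := by
  rw [← Real.rpow_natCast x 6, ← Real.rpow_mul hx, ← Real.rpow_natCast x 2]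
  norm_num

/-! ### §2 The Lamb energy on an `L³`-calm intense set -/

/-- **Hölder `(3/2, 3)` on the intense set + Sobolev.** For an admissible `C²` field `v` with bounded
gradient (`ω = curl v`), a level `L > 0` and `m ≥ 0` with `∫_{|ω| > L} ‖v‖³ ≤ m³`:
`∫_{|ω| > L} ‖v × ω‖² ≤ (m K₆)² ∫ |∇ω|²_F`, `K₆` the tree's `H¹ ⊂ L⁶` constant
(`‖v × ω‖ ≤ ‖v‖‖ω‖`, Hölder on the relatively compact intense set, `∫_S |ω|⁶ ≤ ∫ |ω|⁶ ≤ (K₆‖∇ω‖₂)⁶`,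
`‖∇ω‖²_op ≤ |∇ω|²_F`). [folklore] -/
theorem setIntegral_cross_sq_le_of_calm
    {v : (EuclideanSpace ℝ (Fin 3)) → (EuclideanSpace ℝ (Fin 3))} (hv : ContDiff ℝ 2 v)
    (hG : Integrable fun x => ‖fderiv ℝ v x‖ ^ 2)
    (hH : Integrable fun x => ‖fderiv ℝ (fderiv ℝ v) x‖ ^ 2) {B : ℝ}
    (hB : ∀ x, ‖fderiv ℝ (fderiv ℝ v) x‖ ≤ B) {B₁ : ℝ} (hB₁ : ∀ x, ‖fderiv ℝ v x‖ ≤ B₁)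
    {L : ℝ} (hL : 0 < L) {m : ℝ} (hm : 0 ≤ m)
    (h3 : ∫ x in {x | L < ‖curl v x‖}, ‖v x‖ ^ 3 ≤ m ^ 3) :
    ∫ x in {x | L < ‖curl v x‖}, ‖cross (v x) (curl v x)‖ ^ 2 ≤
      (m * (SNormLESNormFDerivOfEqConst (EuclideanSpace ℝ (Fin 3))
          (volume : Measure (EuclideanSpace ℝ (Fin 3))) 2 : ℝ)) ^ 2 *
        ∫ x, frobeniusNormSq (fderiv ℝ (curl v) x) := by
  set K₆ : ℝ := (SNormLESNormFDerivOfEqConst (EuclideanSpace ℝ (Fin 3))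
    (volume : Measure (EuclideanSpace ℝ (Fin 3))) 2 : ℝ) with hK₆
  have hK₆0 : 0 ≤ K₆ := NNReal.coe_nonneg _
  have hvc : Continuous v := hv.continuous
  have hω1 : ContDiff ℝ 1 (curl v) := contDiff_curl (n := 1) (by exact hv)
  have hωc : Continuous (curl v) := hω1.continuous
  have hDω : Continuous (fderiv ℝ (curl v)) := hω1.continuous_fderiv one_ne_zero
  have hB₁0 : 0 ≤ B₁ := (norm_nonneg _).trans (hB₁ 0)
  have hωbd : ∀ x, ‖curl v x‖ ≤ ‖curlCLM‖ * B₁ := fun x =>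
    (norm_curl_le v x).trans (mul_le_mul_of_nonneg_left (hB₁ x) (norm_nonneg _))
  -- integrability
  have Iω : Integrable fun x => ‖curl v x‖ ^ 2 := by
    refine (hG.const_mul (‖curlCLM‖ ^ 2)).mono' ((hωc.norm.pow 2).aestronglyMeasurable)
      (Eventually.of_forall fun x => ?_)
    rw [Real.norm_of_nonneg (sq_nonneg _), ← mul_pow]
    exact pow_le_pow_left₀ (norm_nonneg _) (norm_curl_le v x) 2
  have hDωle : ∀ x, ‖fderiv ℝ (curl v) x‖ ≤ ‖curlCLM‖ * ‖fderiv ℝ (fderiv ℝ v) x‖ := fun x => by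
    rw [fderiv_curl hv]
    exact ContinuousLinearMap.opNorm_comp_le _ _
  have IDω : Integrable fun x => ‖fderiv ℝ (curl v) x‖ ^ 2 := by
    refine (hH.const_mul (‖curlCLM‖ ^ 2)).mono' ((hDω.norm.pow 2).aestronglyMeasurable)
      (Eventually.of_forall fun x => ?_)
    rw [Real.norm_of_nonneg (sq_nonneg _), ← mul_pow]
    exact pow_le_pow_left₀ (norm_nonneg _) (hDωle x) 2
  have Ifω : Integrable fun x => frobeniusNormSq (fderiv ℝ (curl v) x) := by
    refine (IDω.const_mul 3).mono' (continuous_frobeniusNormSq_fderiv hω1 one_ne_zero).aestronglyMeasurable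
      (Eventually.of_forall fun x => ?_)
    rw [Real.norm_of_nonneg (frobeniusNormSq_nonneg _)]
    exact frobeniusNormSq_le_three_mul _
  have I6 : Integrable fun x => ‖curl v x‖ ^ 6 := by
    refine (Iω.const_mul ((‖curlCLM‖ * B₁) ^ 4)).mono' ((hωc.norm.pow 6).aestronglyMeasurable)
      (Eventually.of_forall fun x => ?_)
    rw [Real.norm_of_nonneg (by positivity)]
    have h4 : ‖curl v x‖ ^ 4 ≤ (‖curlCLM‖ * B₁) ^ 4 := pow_le_pow_left₀ (norm_nonneg _) (hωbd x) 4
    calc ‖curl v x‖ ^ 6 = ‖curl v x‖ ^ 4 * ‖curl v x‖ ^ 2 := by ring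
      _ ≤ (‖curlCLM‖ * B₁) ^ 4 * ‖curl v x‖ ^ 2 :=
          mul_le_mul_of_nonneg_right h4 (sq_nonneg _)
  -- the intense set, a compact container, finite measure
  set S : Set (EuclideanSpace ℝ (Fin 3)) := {x | L < ‖curl v x‖} with hS
  have hSm : MeasurableSet S := (isOpen_lt continuous_const hωc.norm).measurableSet
  obtain ⟨t, ht, htS⟩ : ∃ t : Set (EuclideanSpace ℝ (Fin 3)), IsCompact t ∧ S ⊆ t :=
    exists_isCompact_superlevel_subset (tendsto_curl_cocompact hv hG hB) hL
  have hSfin : volume S < ⊤ := (measure_mono htS).trans_lt ht.measure_lt_top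
  haveI : IsFiniteMeasure (volume.restrict S) := isFiniteMeasure_restrict.2 hSfin.ne
  obtain ⟨Cv, hCv⟩ := ht.exists_bound_of_continuousOn hvc.continuousOn
  -- the two Hölder factors
  set f : (EuclideanSpace ℝ (Fin 3)) → ℝ := fun x => ‖v x‖ ^ 2 with hf
  set g : (EuclideanSpace ℝ (Fin 3)) → ℝ := fun x => ‖curl v x‖ ^ 2 with hg
  have hfc : Continuous f := hvc.norm.pow 2
  have hgc : Continuous g := hωc.norm.pow 2
  have hfm : MemLp f (ENNReal.ofReal (3 / 2)) (volume.restrict S) := by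
    refine (memLp_top_of_bound hfc.aestronglyMeasurable (Cv ^ 2) ?_).mono_exponent le_top
    refine (ae_restrict_iff' hSm).2 (Eventually.of_forall fun x hx => ?_)
    rw [hf, Real.norm_of_nonneg (sq_nonneg _)]
    exact pow_le_pow_left₀ (norm_nonneg _) (hCv x (htS hx)) 2
  have hgm : MemLp g (ENNReal.ofReal 3) (volume.restrict S) := by
    refine (memLp_top_of_bound hgc.aestronglyMeasurable ((‖curlCLM‖ * B₁) ^ 2) ?_).mono_exponent le_top
    refine Eventually.of_forall fun x => ?_
    rw [hg, Real.norm_of_nonneg (sq_nonneg _)]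
    exact pow_le_pow_left₀ (norm_nonneg _) (hωbd x) 2
  have hHC : (3 / 2 : ℝ).HolderConjugate 3 :=
    { inv_add_inv_eq_inv := by norm_num
      left_pos := by norm_num
      right_pos := by norm_num }
  have hHolder := integral_mul_le_Lp_mul_Lq_of_nonneg (μ := volume.restrict S) hHC
    (Eventually.of_forall fun x => sq_nonneg _) (Eventually.of_forall fun x => sq_nonneg _) hfm hgm
  -- the factors
  have hf3 : ∫ x in S, f x ^ (3 / 2 : ℝ) = ∫ x in S, ‖v x‖ ^ 3 :=
    integral_congr_ae (Eventually.of_forall fun x => Lemma142.sq_rpow_three_halves (norm_nonneg _))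
  have hg3 : ∫ x in S, g x ^ (3 : ℝ) = ∫ x in S, ‖curl v x‖ ^ 6 :=
    integral_congr_ae (Eventually.of_forall fun x => sq_rpow_three (norm_nonneg _))
  set Dop : ℝ := ∫ x, ‖fderiv ℝ (curl v) x‖ ^ 2 with hDop
  have hDop0 : 0 ≤ Dop := integral_nonneg fun x => sq_nonneg _
  have hsob := FarhatGrujic2018.integral_norm_pow_six_le hω1 Iω IDω I6
  have h6S : ∫ x in S, ‖curl v x‖ ^ 6 ≤ (K₆ * Real.sqrt Dop) ^ 6 :=
    (setIntegral_le_integral I6 (Eventually.of_forall fun x => by positivity)).trans hsob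
  have hA : (∫ x in S, f x ^ (3 / 2 : ℝ)) ^ (1 / (3 / 2 : ℝ)) ≤ m ^ 2 := by
    rw [hf3, show (1 : ℝ) / (3 / 2) = 2 / 3 by norm_num, ← rpow_three_twoThirds hm]
    exact Real.rpow_le_rpow (setIntegral_nonneg hSm fun x _ => by positivity) h3 (by norm_num)
  have hBfac : (∫ x in S, g x ^ (3 : ℝ)) ^ (1 / (3 : ℝ)) ≤ (K₆ * Real.sqrt Dop) ^ 2 := by
    rw [hg3, ← pow_six_rpow_third (by positivity : 0 ≤ K₆ * Real.sqrt Dop)]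
    exact Real.rpow_le_rpow (setIntegral_nonneg hSm fun x _ => by positivity) h6S (by norm_num)
  have hsq : (K₆ * Real.sqrt Dop) ^ 2 = K₆ ^ 2 * Dop := by
    rw [mul_pow, Real.sq_sqrt hDop0]
  -- the Lamb energy is dominated by `∫_S f g`
  have IX : IntegrableOn (fun x => ‖cross (v x) (curl v x)‖ ^ 2) S :=
    (((crossCLM.continuous₂.comp₂ hvc hωc).norm.pow 2).continuousOn.integrableOn_compact ht).mono_set htS
  have Ifg : IntegrableOn (fun x => f x * g x) S :=
    ((hfc.mul hgc).continuousOn.integrableOn_compact ht).mono_set htS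
  have hΛfg : ∫ x in S, ‖cross (v x) (curl v x)‖ ^ 2 ≤ ∫ x in S, f x * g x := by
    refine integral_mono IX Ifg fun x => ?_
    simp only [hf, hg]
    rw [← mul_pow]
    exact pow_le_pow_left₀ (norm_nonneg _) (norm_cross_le_norm_mul_norm _ _) 2
  have hDopD : Dop ≤ ∫ x, frobeniusNormSq (fderiv ℝ (curl v) x) :=
    integral_mono IDω Ifω fun x => sq_opNorm_le_frobeniusNormSq _
  calc ∫ x in S, ‖cross (v x) (curl v x)‖ ^ 2 ≤ ∫ x in S, f x * g x := hΛfg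
    _ ≤ (∫ x in S, f x ^ (3 / 2 : ℝ)) ^ (1 / (3 / 2 : ℝ)) * (∫ x in S, g x ^ (3 : ℝ)) ^ (1 / (3 : ℝ)) :=
        hHolder
    _ ≤ m ^ 2 * (K₆ * Real.sqrt Dop) ^ 2 :=
        mul_le_mul hA hBfac (Real.rpow_nonneg (setIntegral_nonneg hSm fun x _ => by positivity) _)
          (sq_nonneg _)
    _ = (m * K₆) ^ 2 * Dop := by rw [hsq]; ring
    _ ≤ (m * K₆) ^ 2 * ∫ x, frobeniusNormSq (fderiv ℝ (curl v) x) :=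
        mul_le_mul_of_nonneg_left hDopD (sq_nonneg _)

/-! ### §3 Plate A34-A -/

/-- **A34-A at `t₀ = 0`.** Let `ν > 0`, `T > 0`, `0 < ε₀ < √3/4`, `ε₁ > 0`, and let `C ≥ 0` be a Lamb
pairing constant at width `η = (√3/(4ε₀) − 1)/2` with `C K₆ ε₁ ≤ 1`. For a classical unforced
Navier–Stokes solution on `ℝ³ × [0, T)` with all `L²` Sobolev seminorms bounded on every `[0, T'']`,
`T'' < T`, satisfying `CriticalCalm u ν T 0 ε₀ ε₁`, the plates V34 and G34 give
`∫⁻|∇u(t)|²_F ≤ K(T − t)^{−a}` on `[0, T)`, `a = (2/√3)(1+η)ε₀ < 1/2`. [folklore] -/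
theorem criticalCalmPowerBound_zero (hV : ValueCutoffLowStretching) (hGr : ForcedPowerGronwallSlab)
    {ν T ε₀ ε₁ C : ℝ} (hν : 0 < ν) (hTpos : 0 < T) (hε₀ : 0 < ε₀) (hε₀' : ε₀ < Real.sqrt 3 / 4)
    (hε₁ : 0 < ε₁) (hC0 : 0 ≤ C)
    (hC : ∀ (L : ℝ), 0 < L →
      ∀ ⦃v : (EuclideanSpace ℝ (Fin 3)) → (EuclideanSpace ℝ (Fin 3))⦄ (_ : ContDiff ℝ 2 v)
        (_ : VectorCalculus.IsDivFree v)
        (_ : Integrable fun x => ‖v x‖ ^ 2) (_ : Integrable fun x => ‖fderiv ℝ v x‖ ^ 2)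
        (_ : Integrable fun x => ‖fderiv ℝ (fderiv ℝ v) x‖ ^ 2)
        (_ : ∃ B : ℝ, ∀ x, ‖fderiv ℝ (fderiv ℝ v) x‖ ≤ B),
        2 * ∫ x, (1 - radialCutoff L ((1 + (Real.sqrt 3 / (4 * ε₀) - 1) / 2) * L) (curl v x)) *
            ⟪curl v x, fderiv ℝ v x (curl v x)⟫ ≤
          C * Real.sqrt (∫ x, frobeniusNormSq (fderiv ℝ (curl v) x)) *
            Real.sqrt (∫ x in {x | L < ‖curl v x‖}, ‖cross (v x) (curl v x)‖ ^ 2))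
    (hsmall : C * (SNormLESNormFDerivOfEqConst (EuclideanSpace ℝ (Fin 3))
      (volume : Measure (EuclideanSpace ℝ (Fin 3))) 2 : ℝ) * ε₁ ≤ 1)
    {u : ℝ → (EuclideanSpace ℝ (Fin 3)) → (EuclideanSpace ℝ (Fin 3))}
    {p : ℝ → (EuclideanSpace ℝ (Fin 3)) → ℝ}
    (hsol : IsClassicalNSSolutionOn (Ico 0 T) ν 0 u p)
    (hreg : ∀ T'' < T, HasBoundedSobolevNormsOn (Icc 0 T'') u)
    (hcalm : CriticalCalm u ν T 0 ε₀ ε₁) :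
    ∃ K a : ℝ, 0 ≤ K ∧ a < 1 / 2 ∧ ∀ t ∈ Ico 0 T,
      (∫⁻ x, ENNReal.ofReal (frobeniusNormSq (fderiv ℝ (u t) x))) ≤
        ENNReal.ofReal (K * (T - t) ^ (-a)) := by
  set K₆ : ℝ := (SNormLESNormFDerivOfEqConst (EuclideanSpace ℝ (Fin 3))
    (volume : Measure (EuclideanSpace ℝ (Fin 3))) 2 : ℝ) with hK₆
  have hK₆0 : 0 ≤ K₆ := NNReal.coe_nonneg _
  obtain ⟨hη, ha0, ha⟩ := exponent_of_lt_sqrt_three_div_four hε₀ hε₀'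
  set η : ℝ := (Real.sqrt 3 / (4 * ε₀) - 1) / 2 with hηdef
  set a : ℝ := 2 / Real.sqrt 3 * (1 + η) * ε₀ with hadef
  set Y₀ : ℝ := ∫ x, ‖curl (u 0) x‖ ^ 2 with hY₀
  have hY₀0 : 0 ≤ Y₀ := integral_nonneg fun x => sq_nonneg _
  have hTa : 0 ≤ T ^ a := Real.rpow_nonneg hTpos.le _
  refine ⟨Y₀ * T ^ a, a, mul_nonneg hY₀0 hTa, ha, ?_⟩
  intro t ht
  -- a closed slab containing `t`
  set T'' : ℝ := (t + T) / 2 with hT''def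
  have htT'' : t < T'' := by rw [hT''def]; linarith [ht.2]
  have hT''T : T'' < T := by rw [hT''def]; linarith [ht.2]
  have hT''pos : 0 < T'' := lt_of_le_of_lt ht.1 htT''
  have hS : IsClassicalNSSolutionOn (Icc 0 T'') ν 0 u p :=
    hsol.mono (Icc_subset_Ico_right hT''T) (uniqueDiffOn_Icc hT''pos)
  have hB : HasBoundedSobolevNormsOn (Icc 0 T'') u := hreg T'' hT''T
  have htS : t ∈ Icc 0 T'' := ⟨ht.1, htT''.le⟩
  obtain ⟨B₁, B₂, -, -, hpk⟩ := slice_package hS hB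
  -- the stretching inequality on the slab (V34 + L34 + Hölder/Sobolev absorption)
  have hstrS : ∀ s ∈ Icc 0 T'',
      2 * ∫ x, ⟪curl (u s) x, fderiv ℝ (u s) x (curl (u s) x)⟫ ≤
        ν * (∫ x, frobeniusNormSq (fderiv ℝ (curl (u s)) x)) +
          a / (T - s) * (∫ x, ‖curl (u s) x‖ ^ 2) + 0 * (T - s) ^ (-(0 : ℝ)) := by
    intro s hs
    have hsT : s ∈ Ico 0 T := ⟨hs.1, hs.2.trans_lt hT''T⟩
    have hTs : 0 < T - s := by linarith [hsT.2]
    obtain ⟨hv3, hdiv, i0, i1, i2, hB₁, hB₂⟩ := hpk s hs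
    have hv2 : ContDiff ℝ 2 (u s) := hv3.of_le (by norm_cast)
    have hωc : Continuous (curl (u s)) := continuous_curl (hv2.of_le (by norm_num))
    have hL : 0 < ε₀ / (T - s) := div_pos hε₀ hTs
    have hmain := two_mul_integral_stretching_le_lamb hV hη hC hL hv2 hdiv i0 i1 i2 hB₂ hB₁
    set D : ℝ := ∫ x, frobeniusNormSq (fderiv ℝ (curl (u s)) x) with hD
    set Y : ℝ := ∫ x, ‖curl (u s) x‖ ^ 2 with hY
    set Λ : ℝ := ∫ x in {x | ε₀ / (T - s) < ‖curl (u s) x‖}, ‖cross (u s x) (curl (u s) x)‖ ^ 2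
      with hΛ
    have hD0 : 0 ≤ D := integral_nonneg fun x => frobeniusNormSq_nonneg _
    have hY0 : 0 ≤ Y := integral_nonneg fun x => sq_nonneg _
    -- the door hypothesis at time `s`, as `∫_S ‖u‖³ ≤ (ε₁ν)³`
    have h3 : ∫ x in {x | ε₀ / (T - s) < ‖curl (u s) x‖}, ‖u s x‖ ^ 3 ≤ (ε₁ * ν) ^ 3 := by
      have hset : {x | ε₀ / (T - s) < ‖curl (u s) x‖} = {x | ε₀ < (T - s) * ‖curl (u s) x‖} := by
        ext x
        simp only [mem_setOf_eq]
        rw [div_lt_iff₀ hTs, mul_comm]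
      rw [hset]
      exact setIntegral_norm_cube_le_of_lintegral_le hv2.continuous (hcalm s hsT) (by positivity)
    have hΛle : Λ ≤ (ε₁ * ν * K₆) ^ 2 * D :=
      setIntegral_cross_sq_le_of_calm hv2 i1 i2 hB₂ hB₁ hL (by positivity) h3
    -- absorption: `C √D √Λ ≤ (C K₆ ε₁) ν D ≤ ν D`
    have hsqrtΛ : Real.sqrt Λ ≤ ε₁ * ν * K₆ * Real.sqrt D := by
      calc Real.sqrt Λ ≤ Real.sqrt ((ε₁ * ν * K₆) ^ 2 * D) := Real.sqrt_le_sqrt hΛle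
        _ = ε₁ * ν * K₆ * Real.sqrt D := by
            rw [Real.sqrt_mul (sq_nonneg _), Real.sqrt_sq (by positivity)]
    have habs : C * Real.sqrt D * Real.sqrt Λ ≤ ν * D := by
      calc C * Real.sqrt D * Real.sqrt Λ ≤ C * Real.sqrt D * (ε₁ * ν * K₆ * Real.sqrt D) :=
            mul_le_mul_of_nonneg_left hsqrtΛ (by positivity)
        _ = (C * K₆ * ε₁) * (ν * D) := by
            have hDD : Real.sqrt D * Real.sqrt D = D := Real.mul_self_sqrt hD0
            calc C * Real.sqrt D * (ε₁ * ν * K₆ * Real.sqrt D)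
                = (C * K₆ * ε₁) * ν * (Real.sqrt D * Real.sqrt D) := by ring
              _ = (C * K₆ * ε₁) * (ν * D) := by rw [hDD]; ring
        _ ≤ 1 * (ν * D) := mul_le_mul_of_nonneg_right hsmall (by positivity)
        _ = ν * D := one_mul _
    have hcoef : 2 / Real.sqrt 3 * ((1 + η) * (ε₀ / (T - s))) = a / (T - s) := by
      rw [hadef]
      ring
    calc 2 * ∫ x, ⟪curl (u s) x, fderiv ℝ (u s) x (curl (u s) x)⟫
        ≤ 2 / Real.sqrt 3 * ((1 + η) * (ε₀ / (T - s))) * Y + C * Real.sqrt D * Real.sqrt Λ := hmain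
      _ ≤ a / (T - s) * Y + ν * D := by rw [hcoef]; exact add_le_add le_rfl habs
      _ = ν * D + a / (T - s) * Y + 0 * (T - s) ^ (-(0 : ℝ)) := by ring
  -- the forced power Grönwall inequality on the slab (`β = 0`, `c = 0`)
  have hYt := hGr ν T T'' a 0 0 hν hT''pos hT''T ha0 le_rfl (by linarith) u p hS hB hstrS t htS
  rw [zero_mul, zero_div, add_zero] at hYt
  -- `∫⁻|∇u|²_F ≤ ∫|ω|²`
  obtain ⟨hv3, hdiv, i0, i1, -, -, -⟩ := hpk t htS
  have hYint : Integrable fun x => ‖curl (u t) x‖ ^ 2 := by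
    refine (i1.const_mul (‖curlCLM‖ ^ 2)).mono'
      (((continuous_curl (hv3.of_le (by norm_cast))).norm.pow 2).aestronglyMeasurable)
      (Eventually.of_forall fun x => ?_)
    rw [Real.norm_of_nonneg (sq_nonneg _), ← mul_pow]
    exact pow_le_pow_left₀ (norm_nonneg _) (norm_curl_le (u t) x) 2
  exact lintegral_frobeniusNormSq_le_of_integral_curl_sq_le (hv3.of_le (by norm_cast)) hdiv i0 hYint hYt

/-- **Plate A34-A «CriticalCalmPowerBoundAssembly» PROVED**: `ValueCutoffLowStretching →
LambPairingBound → ForcedPowerGronwallSlab → CriticalCalmPowerBound` (the Prop names of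
`Theorems/IntenseSetDoorsDefs.lean`). Given `ε₀`: `η := (√3/(4ε₀) − 1)/2`, `C := C_η` from L34,
`ε₁ := 1/(C K₆ + 1)` (depends on `ε₀` only); then time translation and `criticalCalmPowerBound_zero`
(`CriticalCalm` translates since `T − t = (T − t₀) − (t − t₀)`). [folklore] -/
theorem criticalCalmPowerBoundAssembly_holds : CriticalCalmPowerBoundAssembly := by
  intro hV hL hGr ε₀ hε₀ hε₀'
  set K₆ : ℝ := (SNormLESNormFDerivOfEqConst (EuclideanSpace ℝ (Fin 3))
    (volume : Measure (EuclideanSpace ℝ (Fin 3))) 2 : ℝ) with hK₆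
  have hK₆0 : 0 ≤ K₆ := NNReal.coe_nonneg _
  obtain ⟨hη, -, -⟩ := exponent_of_lt_sqrt_three_div_four hε₀ hε₀'
  obtain ⟨C, hC0, hC⟩ := hL _ hη
  refine ⟨1 / (C * K₆ + 1), by positivity, ?_⟩
  intro ν T t₀ hν ht₀ ht₀T u p hsol hreg hcalm
  have hsmall : C * K₆ * (1 / (C * K₆ + 1)) ≤ 1 := by
    rw [mul_one_div, div_le_one (by positivity)]
    linarith
  have hTt : 0 < T - t₀ := by linarith
  have hsol' : IsClassicalNSSolutionOn (Ico 0 (T - t₀)) ν 0 (fun t => u (t + t₀))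
      (fun t => p (t + t₀)) := hsol.translate_Ico_zero ht₀
  have hreg' : ∀ T'' < T - t₀, HasBoundedSobolevNormsOn (Icc 0 T'') (fun t => u (t + t₀)) := by
    intro T'' hT'' n
    obtain ⟨C', hC'⟩ := hreg (T'' + t₀) (by linarith) n
    exact ⟨C', fun t ht => hC' (t + t₀) ⟨by linarith [ht.1], by linarith [ht.2]⟩⟩
  have hcalm' : CriticalCalm (fun t => u (t + t₀)) ν (T - t₀) 0 ε₀ (1 / (C * K₆ + 1)) := by
    intro t ht
    have h := hcalm (t + t₀) ⟨by linarith [ht.1], by linarith [ht.2]⟩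
    have hTT : T - (t + t₀) = T - t₀ - t := by ring
    simp only [hTT] at h
    exact h
  obtain ⟨K, a, hK0, ha, hF⟩ := criticalCalmPowerBound_zero hV hGr hν hTt hε₀ hε₀' (by positivity)
    hC0 hC hsmall hsol' hreg' hcalm'
  refine ⟨K, a, hK0, ha, fun t ht => ?_⟩
  have h := hF (t - t₀) ⟨by linarith [ht.1], by linarith [ht.2]⟩
  have hTT : T - t₀ - (t - t₀) = T - t := by ring
  simp only [sub_add_cancel, hTT] at h
  exact h

end Summit.NavierStokesRegularity.NavierStokesRegularity.Theorems.IntenseSetDoors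

end
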